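/-
Copyright (c) 2026. All rights reserved.
Released under Apache 2.0 license as described in the file LICENSE.
Authors: abc-iut cell, wave-2 seat abc-iut-L3-t11 (proof-only; G10 rung 3b: the condition (∗_j) of the
author's Comments (6)(b) on [SemiAnbd] Thm 3.7 (iii), assembled modulo the finite-level data and Rmk 2.2.1).
-/
import Literature.AnabelianGeometry.SemiGraphs.TreeFixedEdgePairProofs
import Literature.AnabelianGeometry.SemiGraphs.TreeSystemFixedPoint
import HarnessLib

/-!
# The condition `(∗_j)` of the corrected proof of [SemiAnbd] Thm 3.7 (iii)

Mochizuki, *Semi-graphs of anabelioids*, Publ. RIMS **42** (2006) [MochizukiSemiAnbd2006], Thm 3.7 (iii),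
with the author's *Comments* (2020), (6)(b): for the sets `E_i` of `H`-fixed edges of the trees `G_{i,∞}`
and their images `E_{j,i} ⊆ E_j`, "(∗_j) there exists an `i ∈ J` such that `i ≥ j` and `#E_{j,i} = 1`.
Indeed, suppose that (∗_j) fails to hold. Then for each `i ≥ j` in `J`, there exists a pair of distinct edges
`e_i, e'_i ∈ E_i` whose respective images `e_{j,i}, e'_{j,i} ∈ E_j` are distinct. By Lemma 1.8, (ii), (b), we
may assume … the pair … forms a subjoint. Then since … [the map to the finite level is a covering], the
respective images `f_{j,i}, f'_{j,i}` in `G_j` also form a subjoint … the pair `(f_i, f'_i)` forms a subjoint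
(of `G_i`). Moreover, for some cofinal subset `J* ⊆ J`, the subjoints `(f_i, f'_i)`, `i ∈ J*`, converge, in
the profinite topology, to some profinite subjoint. As discussed … this leads to a contradiction, in light of
our assumption that `G` is totally estranged."

This PROOF-ONLY file proves `(∗_j)` in exactly this way, for a subgroup `C` of a group `P` acting on a directed
system of TREES `T i` (transition morphisms `f`, NOT assumed immersive) lying over FINITE semi-graphs `G i`
through equivariant IMMERSIONS `q i` (the universal coverings `G_{i,∞} → G_i`) with functorial equivariant
transition morphisms `gf` compatible with `f` — modulo ONE hypothesis `hnobp` carrying the anabelioid content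
(Rmk 2.2.1 + total estrangement, the "profinite subjoint" contradiction): "if `C` fixes a compatible system of
BRANCH-PAIRS (a vertex with two distinct abutting branches) of the finite levels above some `j₀`, then `C = 1`".
Working with branch-pairs rather than subjoints makes the 'untangled' assumption of loc. cit. unnecessary.

* `hstar_of_noFixedBranchPairSystem` — `C ≠ 1 ⇒ (∗_j)` for every `j`: some level `i ≥ j` at which all
  `C`-fixed edges of `T i` have the same image in `T j`.

Tools: `exists_fixed_branchPair_of_label_ne` (`TreeFixedEdgePairProofs`), `fixed_branchPair_map`
(`TreeFixedBranchPairProofs`), abc-iut-L3-t6's `exists_compatible_of_finite` (Kőnig). No definitions.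
-/

namespace Literature.AnabelianGeometry.SemiGraphs

namespace SemiGraph

open CategoryTheory

universe v u

/-- **`(∗_j)` of the corrected proof of Thm 3.7 (iii), modulo the finite-level data**: see the module
docstring for the data; `hnobp` is the anabelioid input (a nontrivial `C` fixes no compatible system of
branch-pairs of the finite levels). Conclusion: for every `j` there is `i ≥ j` such that any two `C`-fixed
edges of the tree `T i` have the same image in `T j`. [cite: MochizukiSemiAnbd2006, Thm. 3.7(iii) p.41] -/
theorem hstar_of_noFixedBranchPairSystem {P : Type u} [Group P] (C : Subgroup P)
    {J : Type v} [Preorder J] [IsDirectedOrder J]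
    (T : J → SemiGraph.{u}) (hT : ∀ j, (T j).IsTree) (ρ : ∀ j, P →* Aut (T j))
    (f : ∀ ⦃i j : J⦄, i ≤ j → (T j ⟶ T i))
    (G : J → SemiGraph.{u}) [∀ j, Finite (G j).Vertex] [∀ j, Finite (G j).Branch]
    (τ : ∀ j, P →* Aut (G j)) (q : ∀ j, T j ⟶ G j) (hq : ∀ j, IsImmersion (q j))
    (hqe : ∀ (j : J) (g : P), (ρ j g).hom ≫ q j = q j ≫ (τ j g).hom)
    (gf : ∀ ⦃i j : J⦄, i ≤ j → (G j ⟶ G i))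
    (gf_id : ∀ j, gf (le_refl j) = 𝟙 (G j))
    (gf_comp : ∀ ⦃i j k : J⦄ (hij : i ≤ j) (hjk : j ≤ k), gf hjk ≫ gf hij = gf (hij.trans hjk))
    (hgfe : ∀ ⦃i j : J⦄ (h : i ≤ j) (g : P), (τ j g).hom ≫ gf h = gf h ≫ (τ i g).hom)
    (hsq : ∀ ⦃i j : J⦄ (h : i ≤ j), f h ≫ q i = q j ≫ gf h)
    (hnobp : ∀ (j₀ : J) (w : ∀ i : {i : J // j₀ ≤ i}, (G i.1).Vertex)
      (β β' : ∀ i : {i : J // j₀ ≤ i}, (G i.1).Branch),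
      (∀ i, β i ≠ β' i ∧ (G i.1).abuts (β i) = some (w i) ∧ (G i.1).abuts (β' i) = some (w i)) →
      (∀ ⦃i i' : {i : J // j₀ ≤ i}⦄ (h : i.1 ≤ i'.1), (gf h).vertexMap (w i') = w i ∧
        (gf h).branchMap (β i') = β i ∧ (gf h).branchMap (β' i') = β' i) →
      (∀ (i : {i : J // j₀ ≤ i}) (γ : C), (τ i.1 γ).hom.vertexMap (w i) = w i ∧
        (τ i.1 γ).hom.branchMap (β i) = β i ∧ (τ i.1 γ).hom.branchMap (β' i) = β' i) → C = ⊥)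
    (hC : C ≠ ⊥) (j : J) :
    ∃ (i : J) (h : j ≤ i), ∀ e e' : (T i).Edge, (∀ γ : C, (ρ i γ).hom.edgeMap e = e) →
      (∀ γ : C, (ρ i γ).hom.edgeMap e' = e') → (f h).edgeMap e = (f h).edgeMap e' := by
  classical
  by_contra hno
  push Not at hno
  -- index set `J' = {i | j ≤ i}`, directed
  haveI : IsDirectedOrder {i : J // j ≤ i} := by
    refine ⟨fun a b => ?_⟩
    obtain ⟨c, hac, hbc⟩ := exists_ge_ge a.1 b.1
    exact ⟨⟨c, a.2.trans hac⟩, hac, hbc⟩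
  -- restricted actions
  let ρC : ∀ i, C →* Aut (T i) := fun i => (ρ i).comp C.subtype
  let τC : ∀ i, C →* Aut (G i) := fun i => (τ i).comp C.subtype
  have hqeC : ∀ (i : J) (γ : C), (ρC i γ).hom ≫ q i = q i ≫ (τC i γ).hom := fun i γ => hqe i γ
  -- the finite sets `A_i` of `C`-fixed branch-pairs of `G i` whose image at level `j` is a branch-pair
  let X : {i : J // j ≤ i} → Type u := fun i => (G i.1).Vertex × (G i.1).Branch × (G i.1).Branch
  let A : ∀ i, Set (X i) := fun i => {t | t.2.1 ≠ t.2.2 ∧ (G i.1).abuts t.2.1 = some t.1 ∧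
    (G i.1).abuts t.2.2 = some t.1 ∧ (∀ γ : C, (τC i.1 γ).hom.vertexMap t.1 = t.1 ∧
      (τC i.1 γ).hom.branchMap t.2.1 = t.2.1 ∧ (τC i.1 γ).hom.branchMap t.2.2 = t.2.2) ∧
    (gf i.2).branchMap t.2.1 ≠ (gf i.2).branchMap t.2.2}
  let ff : ∀ ⦃i i' : {i : J // j ≤ i}⦄, i ≤ i' → X i' → X i :=
    fun i i' h t => ((gf (show i.1 ≤ i'.1 from h)).vertexMap t.1,
      (gf (show i.1 ≤ i'.1 from h)).branchMap t.2.1, (gf (show i.1 ≤ i'.1 from h)).branchMap t.2.2)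
  have ff_id : ∀ (i : {i : J // j ≤ i}) (x : X i), ff le_rfl x = x := by
    intro i x
    simp only [ff, gf_id, id_vertexMap, id_branchMap, id_eq]
    rfl
  have ff_comp : ∀ ⦃i i' i'' : {i : J // j ≤ i}⦄ (h : i ≤ i') (h' : i' ≤ i'') (x : X i''),
      ff h (ff h' x) = ff (h.trans h') x := by
    intro i i' i'' h h' x
    simp only [ff, ← gf_comp (show i.1 ≤ i'.1 from h) (show i'.1 ≤ i''.1 from h'), comp_vertexMap,
      comp_branchMap, Function.comp_apply]
  -- images at level `j` along the functorial transitions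
  have img : ∀ ⦃i i' : {i : J // j ≤ i}⦄ (h : i ≤ i') (b : (G i'.1).Branch),
      (gf i.2).branchMap ((gf (show i.1 ≤ i'.1 from h)).branchMap b) = (gf i'.2).branchMap b := by
    intro i i' h b
    rw [← Function.comp_apply (f := (gf i.2).branchMap), ← comp_branchMap,
      gf_comp i.2 (show i.1 ≤ i'.1 from h)]
  -- equivariance on elements
  have eqV : ∀ ⦃i i' : J⦄ (h : i ≤ i') (γ : C) (x : (G i').Vertex),
      (τC i γ).hom.vertexMap ((gf h).vertexMap x) = (gf h).vertexMap ((τC i' γ).hom.vertexMap x) := by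
    intro i i' h γ x
    have := congrArg (fun ψ : G i' ⟶ G i => ψ.vertexMap x) (hgfe h γ)
    exact this.symm
  have eqB : ∀ ⦃i i' : J⦄ (h : i ≤ i') (γ : C) (b : (G i').Branch),
      (τC i γ).hom.branchMap ((gf h).branchMap b) = (gf h).branchMap ((τC i' γ).hom.branchMap b) := by
    intro i i' h γ b
    have := congrArg (fun ψ : G i' ⟶ G i => ψ.branchMap b) (hgfe h γ)
    exact this.symm
  have hmap : ∀ ⦃i i' : {i : J // j ≤ i}⦄ (h : i ≤ i') (x : X i'), x ∈ A i' → ff h x ∈ A i := by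
    rintro i i' h ⟨w, b, b'⟩ ⟨hbb, hb, hb', hfix, himg⟩
    have himg' : (gf i.2).branchMap ((gf (show i.1 ≤ i'.1 from h)).branchMap b) ≠
        (gf i.2).branchMap ((gf (show i.1 ≤ i'.1 from h)).branchMap b') := by
      rw [img h b, img h b']; exact himg
    refine ⟨fun heq => himg' (congrArg (gf i.2).branchMap heq), (gf _).abuts_branchMap _ _ hb,
      (gf _).abuts_branchMap _ _ hb', fun γ => ⟨?_, ?_, ?_⟩, himg'⟩
    · show (τC i.1 γ).hom.vertexMap ((gf _).vertexMap w) = (gf _).vertexMap w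
      rw [eqV, (hfix γ).1]
    · show (τC i.1 γ).hom.branchMap ((gf _).branchMap b) = (gf _).branchMap b
      rw [eqB, (hfix γ).2.1]
    · show (τC i.1 γ).hom.branchMap ((gf _).branchMap b') = (gf _).branchMap b'
      rw [eqB, (hfix γ).2.2]
  -- every `A_i` is nonempty: Comments (6)(b) — a fixed branch-pair of `T i` at a jump of the label
  -- `(f _).edgeMap`, pushed down to `G i` along the immersion `q i`
  have hne : ∀ i, (A i).Nonempty := by
    intro i
    obtain ⟨e, e', he, he', hee⟩ := hno i.1 i.2
    obtain ⟨v, c, c', -, hcv, hc'v, hlab, hfix⟩ :=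
      exists_fixed_branchPair_of_label_ne (ρC i.1) (hT i.1) (fun E => (f i.2).edgeMap E) hee
        (fun γ => he γ) (fun γ => he' γ)
    have hcc : c ≠ c' := fun h => hlab (by rw [h])
    obtain ⟨hne', hd, hd', hfix'⟩ := fixed_branchPair_map (ρC i.1) (τC i.1) (q i.1) (hq i.1) (hqeC i.1)
      hcc hcv hc'v hfix
    refine ⟨((q i.1).vertexMap v, (q i.1).branchMap c, (q i.1).branchMap c'), hne', hd, hd', hfix', ?_⟩
    -- the images at level `j`: through the square `f ≫ q j = q i ≫ gf`, distinct by immersivity of `q j`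
    show (gf i.2).branchMap ((q i.1).branchMap c) ≠ (gf i.2).branchMap ((q i.1).branchMap c')
    have hsq' : ∀ b : (T i.1).Branch, (gf i.2).branchMap ((q i.1).branchMap b) =
        (q j).branchMap ((f i.2).branchMap b) := by
      intro b
      have := congrArg (fun ψ : T i.1 ⟶ G j => ψ.branchMap b) (hsq i.2)
      simpa using this.symm
    rw [hsq' c, hsq' c']
    intro heq
    have h1 : (T j).abuts ((f i.2).branchMap c) = some ((f i.2).vertexMap v) := (f i.2).abuts_branchMap _ _ hcv
    have h2 : (T j).abuts ((f i.2).branchMap c') = some ((f i.2).vertexMap v) := (f i.2).abuts_branchMap _ _ hc'v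
    have := hq j ((f i.2).vertexMap v) (a₁ := ⟨_, h1⟩) (a₂ := ⟨_, h2⟩) (Subtype.ext heq)
    have hbr : (f i.2).branchMap c = (f i.2).branchMap c' := congrArg Subtype.val this
    apply hlab
    rw [← (f i.2).edgeOf_branchMap c, ← (f i.2).edgeOf_branchMap c', hbr]
  have hfin : ∀ i, (A i).Finite := fun i => Set.toFinite _
  obtain ⟨x, hxA, hxc⟩ := exists_compatible_of_finite ff ff_id ff_comp A hfin hne hmap
  -- the compatible system of fixed branch-pairs forces `C = ⊥`
  refine hC (hnobp j (fun i => (x i).1) (fun i => (x i).2.1) (fun i => (x i).2.2)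
    (fun i => ⟨(hxA i).1, (hxA i).2.1, (hxA i).2.2.1⟩) (fun i i' h => ?_) (fun i γ => (hxA i).2.2.2.1 γ))
  have := hxc (show i ≤ i' from h)
  exact ⟨congrArg Prod.fst this, congrArg (fun t => t.2.1) this, congrArg (fun t => t.2.2) this⟩

end SemiGraph

end Literature.AnabelianGeometry.SemiGraphs
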